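import Summits.QuantumFields.YangMills.Theorems.UnitScaleTiltProp7HcoSOfSigmaRows
import Summits.QuantumFields.YangMills.Theorems.UnitScaleTiltProp7CoerciveOfNormG0Comb
import Summits.QuantumFields.YangMills.Theorems.UnitScaleTiltProp7SlotRowOfDeltaEta
import Summits.QuantumFields.YangMills.Theorems.UnitScaleTiltProp7SigmaRowsNorm
import Summits.QuantumFields.YangMills.Theorems.UnitScaleTiltProp7SigmaRowsQSmall
import Summits.QuantumFields.YangMills.Theorems.UnitScaleTiltProp7SigmaE2EArith
import Summits.QuantumFields.YangMills.Theorems.UnitScaleTiltProp7JointSigmaOfCmapTwL1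
import Summits.QuantumFields.YangMills.Theorems.UnitScaleTiltProp7ChartWindows
import Summits.QuantumFields.YangMills.Theorems.UnitScaleTiltProp7LaplaceAFlatLetters
import HarnessLib

/-!
# Route `UnitScaleTilt`, crux K1 «MinimiserStabilityRegPr» (stmt-QuantumFields-19200) — ARCHITECTURE (A′) ON Σ, **THE END-TO-END KNIT OF THE GROWTH SOCKET `hcoS`**:
# `hcoS` ⇐ {(N06) the `norm_G₀ᶜ` row at the comb slots of record, (P-A2⁺) the comb chart-remainder rows on Σ (sup, `ℓ¹`, crude divergence slice)} — EVERY OTHER ROW BY NAME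

Cell `ym3-torus` ∕ fleet seat `ym-ust-19200-p1` (gen 18, route-R E′ growth-side lead ∕ namer).  THEOREMS ONLY (0 `def`, 0 `sorry`); `--supports stmt-QuantumFields-19200`, count-neutral.
YM₃ on T³ is a ladder rung (R3), not the Clay problem; nothing here claims the stub, the crux, `hcoS`, d = 4 or the mass gap — the two analytic inputs are DISPLAYED hypotheses.

WHY.  The growth socket of record (RULING g29-№16) is `hcoS` — [Balaban1985Variational] (141)–(142) on Σ-representatives: at an E–L-critical `W ∈ (6)(e) ∩ 𝔅_k(V)` every competitor
`e^{iX}W` with `X` in (19) ∕ (20) `AvgCondPrint` ∕ (21) `IsLandauPrint` has larger Wilson action.  The half-way door ✓`Prop7HcoSOfMemberRows.hcoS_of_memberRowsS` asked five analytic rows;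
four of them are now theorems of the tree and are consumed here BY NAME: (COERC)∧(LANDAU-S) at the comb slots of record `(Δ^η, RcombL2, Qkc)` from the displayed `norm_G₀ᶜ` datum
(★w1 g14 ✓`Prop7CoerciveOfNormG0Comb.coerc_landau_RcombL2_of_normG₀_of_isLandauPrint` over ★w4 g8 ✓`coercive_slots_DeltaEta_of_normG₀` and ✓`RcombL2_DstarL2_eq_zero_of_isLandauPrint_of_regPr`),
(SLOT) ★px5 g4 ✓`Prop7SlotRowOfDeltaEta.re_inner_DeltaEta_le_of_regPr` (`kK = 4`, `kE ≤ 2442`), (NORM) ✓`c0_mul_sum_norm_sq_le_norm_sq_toL2`, (QSMALL) from ★px6 g5 ✓`Qkc_toL2`, the Σ-identity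
✓`QTw_eq_neg_CmapTw_of_sigma`, `‖toL2B B‖² ≤ 2cB·Σ‖B c‖²` and ✓`qsmall_arith` — so that `aQ‖Q_k X̃‖² = O(a₀c₀ℓ·σ·Σ_ĉ‖C(W,iX)ĉ‖)` is FOURTH order —, (JOINT) ★routeR-w2 g8 ✓`jointRow_of_l1_CmapTw`;
the `κ`-arithmetic and the windows are ✓`Prop7SigmaE2EArith` ∕ ✓`Prop7ChartWindows.windowsS_of_small`; the knit closes through ✓`Prop7HcoSOfGaugedRows.hcoS_of_gaugedRowsS`.
SEAM (located, p1 g18): the slot doors ✓`hcoS_of_sigmaRowsS` ∕ ✓`hcoS_of_memberRowsS` type the Hessian slot `Δx : ∀ F K, W → …` without the comparison height `n`, while the slot of record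
`DeltaEtaSlot F n K c₀` depends on `n` (`η = L^{−(K−n)}`); this file therefore redoes the HESS step per member one door down (same lemmas `coercive_on_landau_of_coercive`, `hess_arith`).

WHAT IS PROVED (ns `…Theorems.Prop7HcoSEndToEnd`): `in19_mono` (radius monotonicity of (19)), three real-arithmetic reshapes, ★★★ `hcoS_of_normG0_of_combRemainderRows` — for L-only weights
`c₀, cB > 0`, `a₀ ≥ 0` (penalty `aQ := a₀·(c₀∕cB)·ℓ³`): HYPOTHESES (N06) `hN06` = per `L` an L-only `B₀` and radius `eN` with, at every `W ∈ RegPr F n K e` (`e ≤ eN`), a right inverse `G₀` of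
`laplaceAK (Δ^η W) D_W (RcombL2 W) D*_W (Qkc W) (Qkc W)† aQ` with `‖G₀f‖ ≤ B₀‖f‖` ([Balaban1985BackgroundPropagators] Thm 3.3∕3.11 — DISPLAYED); (P-A2⁺) `hPA2` = per `(L, B₁′)` L-only
`(eJ, kσ, C₁, C₂, ζ, δ₁)` with, on the `hcoS` binder, SUP `‖C(W,iX)ĉ‖ ≤ kσ·e`, `ℓ¹` `Σ_ĉ‖C(W,iX)ĉ‖ ≤ C₁ℓ⁻¹M + C₂ℓ(K + dv)` and the crude slice `dv ≤ ζK + δ₁ℓ⁻²M` ([Balaban1985Variational]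
(47), (106)–(111); [Balaban1985Averaging] Prop. 5 — DISPLAYED).  CONCLUSION = `hcoS` VERBATIM (the text of ✓`hcoW_of_hcoSigma`'s `hcoS` hypothesis and of S23ᴸ's row).
HONEST SCOPE.  Composition + real arithmetic over landed theorems; the two analytic inputs are displayed; nothing of print is asserted; rung R3, not Clay; YM gap NOT proved.

References: T. Bałaban, CMP 102 (1985) 277–309 [Balaban1985Variational] ((19)–(21) p.281, (44)–(47) pp.285–286, (106)–(111) p.294, (141)–(142) p.299); CMP 99 (1985) 389–434
[Balaban1985BackgroundPropagators] (Thm 3.3 p.399, Thm 3.11 p.416, (3.10)–(3.12) p.392, (3.21) p.394, (3.26) p.395); CMP 98 (1985) 17–51 [Balaban1985Averaging] (Prop. 2 p.26, Prop. 5 (157) p.41);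
CMP 99 (1985) 75–102 [Balaban1985RegularSpaces] ((1.38) p.82).
-/

set_option autoImplicit false
noncomputable section

open scoped BigOperators Matrix.Norms.L2Operator Matrix Topology InnerProductSpace
open Filter NormedSpace

namespace Summit.QuantumFields.YangMills.Theorems.Prop7HcoSEndToEnd

open Literature.MathematicalPhysics.QuantumFieldTheory.Balaban1983to89
open Literature.MathematicalPhysics.QuantumFieldTheory.Balaban1983to89.T3ContinuumYM3Torus
open Literature.MathematicalPhysics.QuantumFieldTheory.Balaban1983to89.T3UnitLawDensityEML (ℰp)
open Literature.MathematicalPhysics.QuantumFieldTheory.Balaban1983to89.T3ConstrainedMinimiser (fibre)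
open Literature.MathematicalPhysics.QuantumFieldTheory.Balaban1983to89.T3PrintedRegularMinimiser
open Literature.MathematicalPhysics.QuantumFieldTheory.Balaban1983to89.T3RegularMinimiser
open Literature.MathematicalPhysics.QuantumFieldTheory.Balaban1983to89.T3Thm1Carrier
open T4Continuum BlockAveraging AveragingRT ExpMeanLog BlockAveragingEMLLinearised BlockAveragingEMLLinearisedBackground BlockAveragingEMLProp2
open B10Eq27TorusAxialLog (pull)
open T3SectALandauChart (emb15 eta eta_pos bgUnits In19)
open B11Eq103H1Complex (BondL2K laplaceAK)
open B7Prop2Explicit (C0 c2')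
open B7Prop3Flat (c3)
open Summit.QuantumFields.YangMills.Theorems.Prop7SPrint (basePt RestrictedPrint AvgCondPrint IsLandauPrint)
open Summit.QuantumFields.YangMills.Theorems.Prop7TPrint (expHermField)
open Summit.QuantumFields.YangMills.Theorems.Prop7SectET3Transport (periodsT3)
open Summit.QuantumFields.YangMills.Theorems.Prop7SectET3HilbertLetters (W₂ toL2 toL2B DL2 DstarL2)
open Summit.QuantumFields.YangMills.Theorems.Prop7SectET3WilsonHessian (DeltaEta DeltaEtaSlot DeltaEtaSlot_apply)
open Summit.QuantumFields.YangMills.Theorems.Prop7SectET3CombLetters (Qkc Qkc_toL2)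
open Summit.QuantumFields.YangMills.Theorems.Prop7QprimeCombL2 (RcombL2)
open Summit.QuantumFields.YangMills.Theorems.Prop7SymAvgTw (QTw CmapTw)
open Summit.QuantumFields.YangMills.Theorems.Prop7CoerciveOfNormG0Comb (coerc_landau_RcombL2_of_normG₀_of_isLandauPrint)
open Summit.QuantumFields.YangMills.Theorems.Prop7HessOnPrintSlice (coercive_on_landau_of_coercive)
open Summit.QuantumFields.YangMills.Theorems.Prop7HcoWOfSigmaRows (hess_arith)
open Summit.QuantumFields.YangMills.Theorems.Prop7HcoWOfSigmaRowsDiv (joint_arith)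
open Summit.QuantumFields.YangMills.Theorems.Prop7SigmaE2EArith (coerc_window chart_window kappa_arith joint_window hess_window)
open Summit.QuantumFields.YangMills.Theorems.Prop7SigmaRowsNorm (c0_mul_sum_norm_sq_le_norm_sq_toL2)
open Summit.QuantumFields.YangMills.Theorems.Prop7SigmaRowsQSmall (sum_norm_sq_le_of_sup_of_sum qsmall_arith)
open Summit.QuantumFields.YangMills.Theorems.Prop7SlotRowOfDeltaEta (re_inner_DeltaEta_le_of_regPr)
open Summit.QuantumFields.YangMills.Theorems.Prop7SigmaIdentityComb (QTw_eq_neg_CmapTw_of_sigma)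
open Summit.QuantumFields.YangMills.Theorems.Prop7JointSigmaOfCmapTwL1 (jointRow_of_l1_CmapTw)
open Summit.QuantumFields.YangMills.Theorems.Prop7ChartWindows (windowsS_of_small)
open Summit.QuantumFields.YangMills.Theorems.Prop7RieszTauFrobNorm (sum_norm_sq_le_two_mul_opNorm_sq)
open Summit.QuantumFields.YangMills.Theorems.Prop7LaplaceAFlatLetters (norm_sq_toL2B)
open Summit.QuantumFields.YangMills.Theorems.Prop7SPrintIn19 (pow_mul_eta)

/-! ## §1 Bookkeeping: (19) is monotone in its radius; three real-arithmetic reshapes -/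

/-- (19) is monotone in the radius `ε₂` (every member is a strict bound by `ε₂` times a positive power of `η`). [bookkeeping; cite: Balaban1985Variational, (19) p.281] -/
theorem in19_mono {F : T3Family} {n K : ℕ} {ε ε' : ℝ} (hε : ε ≤ ε')
    {U₀ U₁ : GaugeField (F.P K) 0 (Matrix.specialUnitaryGroup (Fin 2) ℂ)} {X : PBond (F.P K) 0 → Matrix (Fin 2) (Fin 2) ℂ}
    (h : In19 F n K ε U₀ U₁ X) : In19 F n K ε' U₀ U₁ X := by
  obtain ⟨h1, h2, h3, h4, h5, h6⟩ := h
  have hη := eta_pos F n K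
  refine ⟨h1, h2, fun b => (h3 b).trans_le ?_, fun μ ν x => (h4 μ ν x).trans_le ?_, fun μ x => (h5 μ x).trans_le ?_,
    fun ν x => (h6 ν x).trans_le ?_⟩
  all_goals exact mul_le_mul_of_nonneg_right hε (by positivity)

/-- SLOT reshape: `4c₀t⁻²K + c₀t⁻²(384(et²)² + 2058·et²)M ≤ (4c₀ℓ²)K + (2442c₀ℓ²)·e·(ℓ²)⁻¹·M` for `ℓt = 1`, `0 < t ≤ 1`, `0 ≤ e ≤ 1`.
[bookkeeping; cite: Balaban1985BackgroundPropagators, (3.10) p.392] -/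
theorem slot_reshape {c₀ t e ℓ Kc M R : ℝ} (hc₀ : 0 ≤ c₀) (ht : 0 < t) (ht1 : t ≤ 1) (hℓt : ℓ * t = 1) (he0 : 0 ≤ e) (he1 : e ≤ 1)
    (hM : 0 ≤ M) (h : R ≤ 4 * c₀ * t⁻¹ ^ 2 * Kc + c₀ * t⁻¹ ^ 2 * (384 * (e * t ^ 2) ^ 2 + 2058 * (e * t ^ 2)) * M) :
    R ≤ (4 * c₀ * ℓ ^ 2) * Kc + (2442 * c₀ * ℓ ^ 2) * e * (ℓ ^ 2)⁻¹ * M := by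
  have hℓ : ℓ = t⁻¹ := eq_inv_of_mul_eq_one_left hℓt
  subst hℓ
  have ht0 : t ≠ 0 := ht.ne'
  have h1 : c₀ * t⁻¹ ^ 2 * (384 * (e * t ^ 2) ^ 2 + 2058 * (e * t ^ 2)) * M = c₀ * (384 * (e * t) ^ 2 + 2058 * e) * M := by
    field_simp
  have h2 : (2442 * c₀ * t⁻¹ ^ 2) * e * (t⁻¹ ^ 2)⁻¹ * M = 2442 * c₀ * e * M := by
    field_simp
  rw [h1] at h
  rw [h2]
  have het : (e * t) ^ 2 ≤ e := by
    have het1 : e * t ≤ 1 := by nlinarith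
    have het0 : 0 ≤ e * t := by positivity
    calc (e * t) ^ 2 = (e * t) * (e * t) := sq _
      _ ≤ 1 * (e * 1) := by gcongr
      _ = e := by ring
  have h3 : c₀ * (384 * (e * t) ^ 2 + 2058 * e) * M ≤ 2442 * c₀ * e * M := by
    have : c₀ * (384 * (e * t) ^ 2 + 2058 * e) ≤ c₀ * (384 * e + 2058 * e) := by gcongr
    nlinarith [mul_le_mul_of_nonneg_right this hM]
  linarith

/-- QSMALL reshape of the penalty weight: `a₀(c₀∕cB)ℓ³ · (t²·(cB·(2S))) = (2a₀c₀ℓ)·S` for `ℓt = 1`, `cB ≠ 0`. [bookkeeping; cite: Balaban1985Variational, (44)–(45) p.285] -/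
theorem qweight_reshape {a₀ c₀ cB ℓ t S : ℝ} (hcB : cB ≠ 0) (hℓt : ℓ * t = 1) :
    a₀ * (c₀ / cB) * ℓ ^ 3 * (t ^ 2 * (cB * (2 * S))) = (2 * a₀ * c₀ * ℓ) * S := by
  have : ℓ ^ 3 * t ^ 2 = ℓ := by
    calc ℓ ^ 3 * t ^ 2 = ℓ * (ℓ * t) ^ 2 := by ring
      _ = ℓ := by rw [hℓt]; ring
  calc a₀ * (c₀ / cB) * ℓ ^ 3 * (t ^ 2 * (cB * (2 * S))) = 2 * a₀ * c₀ * (cB / cB) * (ℓ ^ 3 * t ^ 2) * S := by ring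
    _ = (2 * a₀ * c₀ * ℓ) * S := by rw [div_self hcB, this]; ring

/-- Window bookkeeping: `c·e ≤ 1` for every summand `c ≤ T` of a nonnegative total with `T·e ≤ 1`. [bookkeeping; cite: Balaban1985Variational, (106)-(111) p.294] -/
theorem summand_window {c T e : ℝ} (hc : c ≤ T) (he : 0 ≤ e) (hT : T * e ≤ 1) : c * e ≤ 1 :=
  (mul_le_mul_of_nonneg_right hc he).trans hT

/-! ## §2 The end-to-end knit -/

section E2E

variable (c₀ cB a₀ : ℕ → ℝ) [hc₀ : ∀ L : ℕ, Fact (0 < c₀ L)] [hcB : ∀ L : ℕ, Fact (0 < cB L)]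


/-- ★★★ **THE GROWTH SOCKET `hcoS` FROM THE N06 ROW `norm_G₀ᶜ` AND THE COMB CHART-REMAINDER ROWS (P-A2⁺), EVERYTHING ELSE BY NAME.**  L-only weights `c₀, cB > 0`, `a₀ ≥ 0`, penalty
`aQ := a₀(c₀∕cB)ℓ³`.  (N06) `hN06`: at every `W ∈ RegPr F n K e`, `e ≤ eN(L)`, a right inverse `G₀` of `laplaceAK (Δ^η W) D_W (RcombL2 W) D*_W (Qkc W) (Qkc W)† aQ` with `‖G₀f‖ ≤ B₀(L)‖f‖`
([Balaban1985BackgroundPropagators] Thm 3.3∕3.11 — DISPLAYED).  (P-A2⁺) `hPA2`: on the `hcoS` binder, SUP `‖C(W,iX)ĉ‖ ≤ kσe`, `ℓ¹` `Σ_ĉ‖C(W,iX)ĉ‖ ≤ C₁ℓ⁻¹M + C₂ℓ(K + dv)`, crude slice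
`dv ≤ ζK + δ₁ℓ⁻²M` (DISPLAYED).  CONCLUSION: `hcoS` VERBATIM.
[cite: Balaban1985Variational, (141)-(142) p.299, (19)-(21) p.281, (44)-(47) pp.285-286, (106)-(111) p.294; Balaban1985BackgroundPropagators, Thm 3.11 p.416, Thm 3.3 p.399, (3.10)-(3.12) p.392, (3.21) p.394, (3.26) p.395; Balaban1985Averaging, Prop. 5 (157) p.41] -/
theorem hcoS_of_normG0_of_combRemainderRows (ha₀ : ∀ L : ℕ, 0 ≤ a₀ L)
    (hN06 : ∀ (L : ℕ), 1 < L → ∃ B₀ eN : ℝ, 0 < B₀ ∧ 0 < eN ∧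
      ∀ (F : T3Family), F.L = L → ∀ (n K : ℕ) (hnK : n < K) (e : ℝ) (W : GaugeField (F.P K) 0 (Matrix.specialUnitaryGroup (Fin 2) ℂ)),
        0 < e → e ≤ eN → RegPr F n K e W →
        ∃ G₀ : BondL2K ℂ 3 (periodsT3 F K) (c₀ F.L) W₂ →ₗ[ℂ] BondL2K ℂ 3 (periodsT3 F K) (c₀ F.L) W₂,
          laplaceAK (DeltaEtaSlot F n K (c₀ F.L) W) (DL2 F n K (c₀ F.L) W) (RcombL2 F n K (c₀ F.L) W) (DstarL2 F n K (c₀ F.L) W)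
              (Qkc F n K hnK.le (c₀ F.L) (cB F.L) W) (LinearMap.adjoint (Qkc F n K hnK.le (c₀ F.L) (cB F.L) W))
              (((a₀ F.L * (c₀ F.L / cB F.L) * ((F.L : ℝ) ^ (K - n)) ^ 3 : ℝ) : ℂ)) ∘ₗ G₀ = LinearMap.id ∧
          ∀ f, ‖G₀ f‖ ≤ B₀ * ‖f‖)
    (hPA2 : ∀ (L : ℕ), 1 < L → ∀ (B₁' : ℝ), 0 < B₁' → ∃ eJ kσ C₁ C₂ ζ δ₁ : ℝ, 0 < eJ ∧ 0 ≤ kσ ∧ 0 ≤ C₁ ∧ 0 ≤ C₂ ∧ 0 ≤ ζ ∧ 0 ≤ δ₁ ∧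
      ∀ (F : T3Family), F.L = L → ∀ (n K : ℕ) (hnK : n < K) (e : ℝ) (V : GaugeField (F.P n) 0 (Matrix.specialUnitaryGroup (Fin 2) ℂ))
        (W : GaugeField (F.P K) 0 (Matrix.specialUnitaryGroup (Fin 2) ℂ)) (X : PBond (F.P K) 0 → Matrix (Fin 2) (Fin 2) ℂ),
        0 < e → e ≤ eJ → W ∈ regFibrePr F n K hnK.le e V →
        (∀ γ : ℝ → GaugeField (F.P K) 0 (Matrix.specialUnitaryGroup (Fin 2) ℂ), γ 0 = W → (∀ t, γ t ∈ fibre F ℰp n K hnK.le V) →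
          (∀ b, DifferentiableAt ℝ (fun t => ((γ t b : Matrix.specialUnitaryGroup (Fin 2) ℂ) : Matrix (Fin 2) (Fin 2) ℂ)) 0) →
            deriv (fun t => wilsonAction4 (γ t)) 0 = 0) →
        In19 F n K (2 * B₁' * e) W (expHermField X) X → AvgCondPrint F n K hnK.le V W X → IsLandauPrint F n K W X →
          (∀ ĉ : PBond (F.P n) 0, ‖CmapTw F n K hnK.le W (fun b => Complex.I • X b) ĉ‖ ≤ kσ * e) ∧
          ∃ dv : ℝ, ∑ ĉ : PBond (F.P n) 0, ‖CmapTw F n K hnK.le W (fun b => Complex.I • X b) ĉ‖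
              ≤ C₁ * ((F.L : ℝ) ^ (K - n))⁻¹ * (∑ b : PBond (F.P K) 0, ‖X b‖ ^ 2) + C₂ * ((F.L : ℝ) ^ (K - n)) * ((∑ p : Plaq (F.P K) 0, ‖((Complex.I • X ⟨p.src, p.μ⟩) + ((W ⟨p.src, p.μ⟩ : Matrix (Fin 2) (Fin 2) ℂ) * (Complex.I • X ⟨p.src.shift p.μ, p.ν⟩) * star (W ⟨p.src, p.μ⟩ : Matrix (Fin 2) (Fin 2) ℂ))
            - (((W ⟨p.src, p.μ⟩ * W ⟨p.src.shift p.μ, p.ν⟩ * (W ⟨p.src.shift p.ν, p.μ⟩)⁻¹ : Matrix.specialUnitaryGroup (Fin 2) ℂ) : Matrix (Fin 2) (Fin 2) ℂ) * (Complex.I • X ⟨p.src.shift p.ν, p.μ⟩) * star ((W ⟨p.src, p.μ⟩ * W ⟨p.src.shift p.μ, p.ν⟩ * (W ⟨p.src.shift p.ν, p.μ⟩)⁻¹ : Matrix.specialUnitaryGroup (Fin 2) ℂ) : Matrix (Fin 2) (Fin 2) ℂ))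
            - (((GaugeField.plaqHol W p : Matrix.specialUnitaryGroup (Fin 2) ℂ) : Matrix (Fin 2) (Fin 2) ℂ) * (Complex.I • X ⟨p.src, p.ν⟩) * star ((GaugeField.plaqHol W p : Matrix.specialUnitaryGroup (Fin 2) ℂ) : Matrix (Fin 2) (Fin 2) ℂ)))‖ ^ 2) + dv) ∧
            dv ≤ ζ * (∑ p : Plaq (F.P K) 0, ‖((Complex.I • X ⟨p.src, p.μ⟩) + ((W ⟨p.src, p.μ⟩ : Matrix (Fin 2) (Fin 2) ℂ) * (Complex.I • X ⟨p.src.shift p.μ, p.ν⟩) * star (W ⟨p.src, p.μ⟩ : Matrix (Fin 2) (Fin 2) ℂ))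
            - (((W ⟨p.src, p.μ⟩ * W ⟨p.src.shift p.μ, p.ν⟩ * (W ⟨p.src.shift p.ν, p.μ⟩)⁻¹ : Matrix.specialUnitaryGroup (Fin 2) ℂ) : Matrix (Fin 2) (Fin 2) ℂ) * (Complex.I • X ⟨p.src.shift p.ν, p.μ⟩) * star ((W ⟨p.src, p.μ⟩ * W ⟨p.src.shift p.μ, p.ν⟩ * (W ⟨p.src.shift p.ν, p.μ⟩)⁻¹ : Matrix.specialUnitaryGroup (Fin 2) ℂ) : Matrix (Fin 2) (Fin 2) ℂ))
            - (((GaugeField.plaqHol W p : Matrix.specialUnitaryGroup (Fin 2) ℂ) : Matrix (Fin 2) (Fin 2) ℂ) * (Complex.I • X ⟨p.src, p.ν⟩) * star ((GaugeField.plaqHol W p : Matrix.specialUnitaryGroup (Fin 2) ℂ) : Matrix (Fin 2) (Fin 2) ℂ)))‖ ^ 2) + δ₁ * (((F.L : ℝ) ^ (K - n)) ^ 2)⁻¹ * (∑ b : PBond (F.P K) 0, ‖X b‖ ^ 2)) :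
    ∀ (L : ℕ), 1 < L → ∀ (B₁' : ℝ), 0 < B₁' → ∃ e₇ : ℝ, 0 < e₇ ∧
      ∀ (F : T3Family), F.L = L → ∀ (n K : ℕ) (hnK : n < K) (e : ℝ) (V : GaugeField (F.P n) 0 (Matrix.specialUnitaryGroup (Fin 2) ℂ))
        (W : GaugeField (F.P K) 0 (Matrix.specialUnitaryGroup (Fin 2) ℂ)) (X : PBond (F.P K) 0 → Matrix (Fin 2) (Fin 2) ℂ),
        0 < e → e ≤ e₇ → W ∈ regFibrePr F n K hnK.le e V →
        (∀ γ : ℝ → GaugeField (F.P K) 0 (Matrix.specialUnitaryGroup (Fin 2) ℂ), γ 0 = W → (∀ t, γ t ∈ fibre F ℰp n K hnK.le V) →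
          (∀ b, DifferentiableAt ℝ (fun t => ((γ t b : Matrix.specialUnitaryGroup (Fin 2) ℂ) : Matrix (Fin 2) (Fin 2) ℂ)) 0) →
            deriv (fun t => wilsonAction4 (γ t)) 0 = 0) →
        In19 F n K (2 * B₁' * e) W (expHermField X) X → AvgCondPrint F n K hnK.le V W X → IsLandauPrint F n K W X →
          wilsonAction4 W ≤ wilsonAction4 (emb15 W (expHermField X)) := by
  refine Prop7HcoSOfGaugedRows.hcoS_of_gaugedRowsS ?_
  intro L hL B₁' hB₁'
  obtain ⟨B₀, eN, hB₀, heN, HN⟩ := hN06 L hL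
  obtain ⟨eJ, kσ, C₁, C₂, ζ, δ₁, heJ, hkσ, hC₁, hC₂, hζ, hδ₁, HJ⟩ := hPA2 L hL B₁' hB₁'
  have ha₀L := ha₀ L
  -- the L-only QSMALL coefficients and the total window constant
  obtain ⟨kQ, hkQ_def⟩ : ∃ kQ : ℝ, kQ = 2 * a₀ L * kσ * (C₂ * (1 + ζ)) := ⟨_, rfl⟩
  obtain ⟨kQ', hkQ'_def⟩ : ∃ kQ' : ℝ, kQ' = 2 * a₀ L * kσ * (C₁ + C₂ * δ₁) := ⟨_, rfl⟩
  have hkQ : 0 ≤ kQ := by rw [hkQ_def]; positivity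
  have hkQ' : 0 ≤ kQ' := by rw [hkQ'_def]; positivity
  have hL0 : (0 : ℝ) < (L : ℝ) := by exact_mod_cast (show 0 < L by omega)
  obtain ⟨T, hT_def⟩ : ∃ T : ℝ, T = 2058 * B₀ + 8 * B₁' + 2 * B₀ * (2442 + kQ' + 1)
      + 16 * B₀ * (4 + kQ) * (2 * (C₁ + C₂ * δ₁) + 62208 * B₁' ^ 2 + 217) + (16 * (C₂ * (1 + ζ)) + 1)
      + 10 ^ 10 * (L : ℝ) ^ 6 + 10 ^ 9 * (2 * B₁' + 1) * (L : ℝ) ^ 2 + 178 * 10 ^ 7 * (2 * B₁' + 1) * (L : ℝ) ^ 3 := ⟨_, rfl⟩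
  -- signs of the summands
  have t1 : (0 : ℝ) ≤ 2058 * B₀ := by positivity
  have t2 : (0 : ℝ) ≤ 8 * B₁' := by positivity
  have t3 : (0 : ℝ) ≤ 2 * B₀ * (2442 + kQ' + 1) := by positivity
  have t4 : (0 : ℝ) ≤ 16 * B₀ * (4 + kQ) * (2 * (C₁ + C₂ * δ₁) + 62208 * B₁' ^ 2 + 217) := by positivity
  have t5 : (0 : ℝ) ≤ 16 * (C₂ * (1 + ζ)) + 1 := by positivity
  have t6 : (0 : ℝ) ≤ 10 ^ 10 * (L : ℝ) ^ 6 := by positivity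
  have t7 : (0 : ℝ) ≤ 10 ^ 9 * (2 * B₁' + 1) * (L : ℝ) ^ 2 := by positivity
  have t8 : (0 : ℝ) ≤ 178 * 10 ^ 7 * (2 * B₁' + 1) * (L : ℝ) ^ 3 := by positivity
  have hTpos : 0 < T := by rw [hT_def]; linarith [hB₀]
  refine ⟨min eN (min eJ (min 1 T⁻¹)), lt_min heN (lt_min heJ (lt_min one_pos (inv_pos.mpr hTpos))), ?_⟩
  intro F hF n K hnK e V W X he heε hWreg hEL h19 h20 h21
  -- radius bookkeeping
  have heN' : e ≤ eN := heε.trans (min_le_left _ _)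
  have heJ' : e ≤ eJ := (heε.trans (min_le_right _ _)).trans (min_le_left _ _)
  have he1 : e ≤ 1 := ((heε.trans (min_le_right _ _)).trans (min_le_right _ _)).trans (min_le_left _ _)
  have hTe : T * e ≤ 1 := by
    have h := ((heε.trans (min_le_right _ _)).trans (min_le_right _ _)).trans (min_le_right _ _)
    calc T * e ≤ T * T⁻¹ := mul_le_mul_of_nonneg_left h hTpos.le
      _ = 1 := mul_inv_cancel₀ hTpos.ne'
  have w1 : 2058 * B₀ * e ≤ 1 := summand_window (by rw [hT_def]; linarith) he.le hTe
  have w2 : 8 * B₁' * e ≤ 1 := summand_window (by rw [hT_def]; linarith) he.le hTe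
  have w3 : 2 * B₀ * (2442 + kQ' + 1) * e ≤ 1 := summand_window (by rw [hT_def]; linarith) he.le hTe
  have w4 : 16 * B₀ * (4 + kQ) * (2 * (C₁ + C₂ * δ₁) + 62208 * B₁' ^ 2 + 217) * e ≤ 1 := summand_window (by rw [hT_def]; linarith) he.le hTe
  have w5 : (16 * (C₂ * (1 + ζ)) + 1) * e ≤ 1 := summand_window (by rw [hT_def]; linarith) he.le hTe
  have w6 : 10 ^ 10 * (L : ℝ) ^ 6 * e ≤ 1 := summand_window (by rw [hT_def]; linarith) he.le hTe
  have w7 : 10 ^ 9 * (2 * B₁' + 1) * (L : ℝ) ^ 2 * e ≤ 1 := summand_window (by rw [hT_def]; linarith) he.le hTe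
  have w8 : 178 * 10 ^ 7 * (2 * B₁' + 1) * (L : ℝ) ^ 3 * e ≤ 1 := summand_window (by rw [hT_def]; linarith) he.le hTe
  -- member letters
  subst hF
  have hL1 : (1 : ℝ) ≤ (F.L : ℝ) := by exact_mod_cast hL.le
  have hℓpos : (0 : ℝ) < (F.L : ℝ) ^ (K - n) := by positivity
  have hℓ1 : (1 : ℝ) ≤ (F.L : ℝ) ^ (K - n) := one_le_pow₀ hL1
  have hc₀ : (0 : ℝ) < c₀ F.L := (hc₀ F.L).out
  have hcB : (0 : ℝ) < cB F.L := (hcB F.L).out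
  have hPL : (((F.P K).L : ℕ) : ℝ) = (F.L : ℝ) := rfl
  have hη : eta F n K = ((F.L : ℝ) ^ (K - n))⁻¹ := by rw [eta, inv_pow]
  have hηpos : 0 < eta F n K := eta_pos F n K
  have hη1 : eta F n K ≤ 1 := by rw [hη]; exact inv_le_one_of_one_le₀ hℓ1
  have hℓη : (F.L : ℝ) ^ (K - n) * eta F n K = 1 := by rw [hη]; exact mul_inv_cancel₀ hℓpos.ne'
  have hrT : regThreshold F n K e = e * eta F n K ^ 2 := by
    show e * ((F.L : ℝ)⁻¹) ^ (2 * (K - n)) = _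
    rw [eta, pow_mul']
  have hrT' : regThreshold F n K e = e * (((F.L : ℝ) ^ (K - n)) ^ 2)⁻¹ := by rw [hrT, hη, inv_pow]
  obtain ⟨hWfib, hreg⟩ := (mem_regFibrePr_iff F).mp hWreg
  -- the radius of (19) for the Σ-identity: `ε₂ := (2B₁′ + 1)e ≥ e`
  have hε₂pos : 0 < (2 * B₁' + 1) * e := by positivity
  have h2B : 2 * B₁' * e ≤ (2 * B₁' + 1) * e := by rw [add_mul, one_mul]; exact le_add_of_nonneg_right he.le
  have heε₂ : e ≤ (2 * B₁' + 1) * e := by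
    rw [add_mul, one_mul]; exact le_add_of_nonneg_left (by positivity)
  have h19' : In19 F n K ((2 * B₁' + 1) * e) W (expHermField X) X := in19_mono h2B h19
  -- the L-only windows of the chart letters (✓`windowsS_of_small` at `(α, e) := (e, ε₂)`)
  have hL2le6 : (F.L : ℝ) ^ 2 ≤ (F.L : ℝ) ^ 6 := pow_le_pow_right₀ hL1 (by norm_num)
  have hL3le6 : (F.L : ℝ) ^ 3 ≤ (F.L : ℝ) ^ 6 := pow_le_pow_right₀ hL1 (by norm_num)
  have heL6 : e * (F.L : ℝ) ^ 6 ≤ 1 / 10 ^ 10 := by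
    rw [le_div_iff₀ (by positivity)]
    calc e * (F.L : ℝ) ^ 6 * 10 ^ 10 = 10 ^ 10 * (F.L : ℝ) ^ 6 * e := by ring
      _ ≤ 1 := w6
  have hαw : e * (((F.P K).L : ℕ) : ℝ) ^ 2 ≤ 1 / 10 ^ 9 := by
    rw [hPL]
    have h1 : e * (F.L : ℝ) ^ 2 ≤ e * (F.L : ℝ) ^ 6 := mul_le_mul_of_nonneg_left hL2le6 he.le
    linarith
  have hεw : (2 * B₁' + 1) * e * (((F.P K).L : ℕ) : ℝ) ^ 2 ≤ 1 / 10 ^ 9 := by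
    rw [hPL, le_div_iff₀ (by positivity)]
    calc (2 * B₁' + 1) * e * (F.L : ℝ) ^ 2 * 10 ^ 9 = 10 ^ 9 * (2 * B₁' + 1) * (F.L : ℝ) ^ 2 * e := by ring
      _ ≤ 1 := w7
  obtain ⟨hα3, hα4', -, hε20, hsmall, hc₃, hsm, -, -⟩ := windowsS_of_small F K he hε₂pos hαw hεw
  have hα4 : 4 * e ≤ c2' (F.P K).d (F.P K).L := by linarith
  have hε₂4 : (2 * B₁' + 1) * e ≤ 1 / 4 := hε20.trans (by norm_num)
  have he10 : 10 ^ 10 * (F.L : ℝ) ^ 6 * e ≤ 1 := w6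
  have he7 : 10 ^ 7 * (F.L : ℝ) ^ 3 * e ≤ 1 := by
    have h1 : (10 : ℝ) ^ 7 * (F.L : ℝ) ^ 3 ≤ 10 ^ 10 * (F.L : ℝ) ^ 6 :=
      mul_le_mul (by norm_num) hL3le6 (by positivity) (by positivity)
    exact (mul_le_mul_of_nonneg_right h1 he.le).trans w6
  have h178 : 10 ^ 7 * (F.L : ℝ) ^ 3 * (178 * ((2 * B₁' + 1) * e)) ≤ 1 := by
    calc 10 ^ 7 * (F.L : ℝ) ^ 3 * (178 * ((2 * B₁' + 1) * e)) = 178 * 10 ^ 7 * (2 * B₁' + 1) * (F.L : ℝ) ^ 3 * e := by ring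
      _ ≤ 1 := w8
  have he6 : 10 ^ 6 * (F.L : ℝ) ^ 2 * ((2 * B₁' + 1) * e) ≤ 1 := by
    have h0 : 0 ≤ (2 * B₁' + 1) * (F.L : ℝ) ^ 2 * e := by positivity
    calc 10 ^ 6 * (F.L : ℝ) ^ 2 * ((2 * B₁' + 1) * e) = 10 ^ 6 * ((2 * B₁' + 1) * (F.L : ℝ) ^ 2 * e) := by ring
      _ ≤ 10 ^ 9 * ((2 * B₁' + 1) * (F.L : ℝ) ^ 2 * e) := mul_le_mul_of_nonneg_right (by norm_num) h0
      _ = 10 ^ 9 * (2 * B₁' + 1) * (F.L : ℝ) ^ 2 * e := by ring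
      _ ≤ 1 := w7
  -- (COERC) ∧ (LANDAU-S) at the comb slots of record from the N06 datum (★w1 g14 ✓p695339)
  obtain ⟨G₀, hG, hGB⟩ := HN F rfl n K hnK e W he heN' hreg
  have haQ : 0 ≤ a₀ F.L * (c₀ F.L / cB F.L) * ((F.L : ℝ) ^ (K - n)) ^ 3 := by positivity
  obtain ⟨hco, hLS⟩ := coerc_landau_RcombL2_of_normG₀_of_isLandauPrint F hnK.le (c₀ F.L) (cB F.L)
    (a₀ F.L * (c₀ F.L / cB F.L) * ((F.L : ℝ) ^ (K - n)) ^ 3) he hα3 hα4 W hreg haQ hB₀ (coerc_window w1) G₀ hG hGB h21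
  -- HESS on print's slice: `γ‖X̃‖² − aQ‖Q_k X̃‖² ≤ re⟪X̃, Δ^η X̃⟫`
  have h1 : B₀⁻¹ * ‖toL2 F K (c₀ F.L) X‖ ^ 2
      - (a₀ F.L * (c₀ F.L / cB F.L) * ((F.L : ℝ) ^ (K - n)) ^ 3) * ‖Qkc F n K hnK.le (c₀ F.L) (cB F.L) W (toL2 F K (c₀ F.L) X)‖ ^ 2
        ≤ RCLike.re ⟪toL2 F K (c₀ F.L) X, DeltaEta F n K (c₀ F.L) W (toL2 F K (c₀ F.L) X)⟫_ℂ := by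
    have h0 := coercive_on_landau_of_coercive (DeltaEtaSlot F n K (c₀ F.L) W) (DL2 F n K (c₀ F.L) W) (RcombL2 F n K (c₀ F.L) W)
      (DstarL2 F n K (c₀ F.L) W) (Qkc F n K hnK.le (c₀ F.L) (cB F.L) W) (LinearMap.adjoint (Qkc F n K hnK.le (c₀ F.L) (cB F.L) W))
      (((a₀ F.L * (c₀ F.L / cB F.L) * ((F.L : ℝ) ^ (K - n)) ^ 3 : ℝ) : ℂ)) rfl hco hLS
    have ha : RCLike.re (((a₀ F.L * (c₀ F.L / cB F.L) * ((F.L : ℝ) ^ (K - n)) ^ 3 : ℝ) : ℂ))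
        = a₀ F.L * (c₀ F.L / cB F.L) * ((F.L : ℝ) ^ (K - n)) ^ 3 := by rw [RCLike.re_to_complex, Complex.ofReal_re]
    rw [ha, DeltaEtaSlot_apply] at h0
    exact h0
  -- (NORM)
  have hN := c0_mul_sum_norm_sq_le_norm_sq_toL2 F K (c₀ F.L) X
  -- (SLOT) ★px5 ✓p689967, reshaped to `kK = 4`, `kE = 2442`
  have hM : (0 : ℝ) ≤ ∑ b : PBond (F.P K) 0, ‖X b‖ ^ 2 := Finset.sum_nonneg fun b _ => by positivity
  have hSl0 := re_inner_DeltaEta_le_of_regPr (c₀ := c₀ F.L) he.le W hreg X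
  simp only [Pi.smul_apply] at hSl0
  rw [hrT] at hSl0
  have hSl := slot_reshape hc₀.le hηpos hη1 hℓη he.le he1 hM hSl0
  -- (QSMALL) — fourth order: `aQ‖Q_k X̃‖² ≤ 2a₀c₀ℓ·Σ_ĉ‖C(W,iX)ĉ‖²`, then the sup and `ℓ¹` rows (✓`qsmall_arith`)
  obtain ⟨hsup, dv, hbind, hdv⟩ := HJ F rfl n K hnK e V W X he heJ' hWreg hEL h19 h20 h21
  have hSig := QTw_eq_neg_CmapTw_of_sigma F hnK.le he hε₂pos heε₂ hε₂4 he7 h178 he6 hα3 hα4' hsmall hc₃ hsm hWreg h19' h20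
  have hQC : ∀ ĉ : PBond (F.P n) 0, ‖QTw F n K hnK.le W X ĉ‖ = ‖CmapTw F n K hnK.le W (fun b => Complex.I • X b) ĉ‖ := by
    intro ĉ
    have hc := congrFun hSig ĉ
    have hI : QTw F n K hnK.le W (fun b => Complex.I • X b) = Complex.I • QTw F n K hnK.le W X :=
      (QTw F n K hnK.le W).map_smul Complex.I X
    rw [hI, Pi.smul_apply, Pi.neg_apply] at hc
    rw [← norm_neg (CmapTw F n K hnK.le W (fun b => Complex.I • X b) ĉ), ← hc, norm_smul, Complex.norm_I, one_mul]
  have hQn : (a₀ F.L * (c₀ F.L / cB F.L) * ((F.L : ℝ) ^ (K - n)) ^ 3) * ‖Qkc F n K hnK.le (c₀ F.L) (cB F.L) W (toL2 F K (c₀ F.L) X)‖ ^ 2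
      ≤ (2 * a₀ F.L * c₀ F.L * (F.L : ℝ) ^ (K - n)) * ∑ ĉ : PBond (F.P n) 0, ‖CmapTw F n K hnK.le W (fun b => Complex.I • X b) ĉ‖ ^ 2 := by
    have hB : ‖toL2B F n (cB F.L) (QTw F n K hnK.le W X)‖ ^ 2
        ≤ cB F.L * (2 * ∑ ĉ : PBond (F.P n) 0, ‖CmapTw F n K hnK.le W (fun b => Complex.I • X b) ĉ‖ ^ 2) := by
      rw [norm_sq_toL2B]
      refine mul_le_mul_of_nonneg_left ?_ hcB.le
      rw [Finset.mul_sum]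
      refine Finset.sum_le_sum fun ĉ _ => ?_
      rw [← hQC ĉ]
      exact sum_norm_sq_le_two_mul_opNorm_sq _
    have hnorm : ‖Qkc F n K hnK.le (c₀ F.L) (cB F.L) W (toL2 F K (c₀ F.L) X)‖ ^ 2 = eta F n K ^ 2 * ‖toL2B F n (cB F.L) (QTw F n K hnK.le W X)‖ ^ 2 := by
      rw [Qkc_toL2, norm_smul, Complex.norm_real, Real.norm_of_nonneg hηpos.le, mul_pow]
    rw [hnorm, ← qweight_reshape hcB.ne' hℓη]
    exact mul_le_mul_of_nonneg_left (mul_le_mul_of_nonneg_left hB (by positivity)) haQ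
  have hA : 0 ≤ 2 * a₀ F.L * c₀ F.L * (F.L : ℝ) ^ (K - n) := by positivity
  have hQ0 := qsmall_arith hA (by positivity : 0 ≤ kσ * e) hℓpos hC₂
    (sum_norm_sq_le_of_sup_of_sum (fun ĉ => CmapTw F n K hnK.le W (fun b => Complex.I • X b) ĉ) hsup) hbind hdv
  have hq1 : 2 * a₀ F.L * c₀ F.L * (F.L : ℝ) ^ (K - n) * (kσ * e) * (C₂ * (1 + ζ)) * (F.L : ℝ) ^ (K - n)
      = kQ * c₀ F.L * e * ((F.L : ℝ) ^ (K - n)) ^ 2 := by rw [hkQ_def]; ring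
  have hq2 : 2 * a₀ F.L * c₀ F.L * (F.L : ℝ) ^ (K - n) * (kσ * e) * (C₁ + C₂ * δ₁) * (F.L : ℝ) ^ (K - n)
      = kQ' * c₀ F.L * e * ((F.L : ℝ) ^ (K - n)) ^ 2 := by rw [hkQ'_def]; ring
  rw [hq1, hq2] at hQ0
  have hQ := hQn.trans hQ0
  -- `κ` and the HESS row `κ·M ≤ K` (✓`kappa_arith`, ✓`hess_arith`)
  obtain ⟨hposK, hκ⟩ := kappa_arith (B₀ := B₀) (kE := (2442 : ℝ)) (kQ' := kQ') (kK := (4 : ℝ)) (kQ := kQ) (by norm_num) hkQ hc₀ he hℓpos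
  have hHESS := hess_arith hM (inv_pos.mpr hB₀).le h1 hN hSl hQ hposK hκ
  -- (JOINT) in the gauged door's currency (★routeR-w2 ✓`jointRow_of_l1_CmapTw` ∘ ✓`joint_arith`)
  have hJ := jointRow_of_l1_CmapTw F hnK.le he hε₂pos heε₂ hε₂4 he10 h178 he6 hα3 hα4' hsmall hc₃ hsm hWreg h19' h20 hbind
  refine ⟨2 * B₁' * e * ((F.L : ℝ) ^ (K - n))⁻¹, (B₀⁻¹ - (2442 + kQ') * e) / ((4 + kQ * e) * ((F.L : ℝ) ^ (K - n)) ^ 2),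
    C₁ + C₂ * δ₁, C₂ * (1 + ζ), ?_, chart_window hB₁' he hℓ1 w2, hHESS, ?_, joint_window he w5, ?_⟩
  · -- CHART from (19)
    intro b
    have hb := (In19.norm_lt h19 b).le
    rw [inv_pow] at hb
    exact hb
  · intro Q hQ0 hQs
    obtain ⟨μ, hμ, hb⟩ := hJ Q hQ0 hQs
    exact ⟨μ, hμ, hb.trans (joint_arith hℓpos hC₂ hdv)⟩
  · -- the HESS window
    rw [hrT']
    exact hess_window hB₀ (by norm_num) hkQ hC₁ hC₂ hδ₁ hB₁' he hℓpos he1 w3 w4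

end E2E

end Summit.QuantumFields.YangMills.Theorems.Prop7HcoSEndToEnd

end
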